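import Summits.BirchSwinnertonDyer.BirchSwinnertonDyer.Theorems.GenusKolyvaginAtTwoGenusPrimitiveSupplyAtTwoPosDiscShallowKFourPosSelmerCountCurrency
import Summits.BirchSwinnertonDyer.BirchSwinnertonDyer.Theorems.GenusKolyvaginAtTwoGenusDeepSupplyAtTwoNegDiscNarrowKFourCellShaCardCurrency
import Summits.BirchSwinnertonDyer.BirchSwinnertonDyer.Theorems.GenusKolyvaginAtTwoKFourOfShaRatCard
import HarnessLib

/-!
# Route `GenusKolyvaginAtTwo`, crux K₄ `K4Neg` (stmt-BirchSwinnertonDyer-31526) — THE SELMER-COUNT CURRENCY OF K₄ (Δ<0 twin, sign-free lever):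
# on K4Neg's frame + the cut, modulo Q2 ONLY: `#Ш(E/ℚ)[2^∞] = #Sel_(2^M₀)(E/ℚ)`, and
# «K4Neg's conclusion» ⟺ `#Sel_(2^M₀)(E/ℚ) = 4^(M₀)` ⟺ `#Sel_(2^M₀)(E/ℚ) ≠ #Sel_(2^(M₀−1))(E/ℚ)` (depth two: ⟺ `#Sel₄(E/ℚ) ≠ 4`)

Width seat `bsd-line-gk2-p5` g37 (cell `bsd-f1-sign2`), `--supports stmt-BirchSwinnertonDyer-31526 --as helper`; Δ<0 twin of this seat's
`…KFourPosSelmerCountCurrency` (p774671; its §1 is sign-free: `#Sel_(2^m)(E/F) = #Ш(E/F)[2^m]` for `rank E(F) = 0`, `E(F)[2] = 0`) over LEAD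
gk2-p1 g24's `KFourCell.ShaCardCurrency.kFourNeg_conclusion_iff_natCard_sha_rat_eq_pow` (p773559: K4Neg ⟺ `#Ш(E/ℚ)[2^∞] = 4^(M₀)`, mod Q2).
THEOREMS ONLY (no definition, no named fact, no `sorry`); standard axioms.  **BSD is NOT proved by this file; K4Neg is NOT proved; nothing is closed.**

* `natCard_shaPrimary_rat_eq_natCard_selmerGroup_two_pow_of_rank_zero` — SIGN-FREE, mod Q2: on the B₂ frame (non-CM, odd Tamagawa, an odd
  multiplicative prime, `ρ_{E,2^n}` onto, `K` with the two non-squares, `w(E) = +1`, `2^(M₀+1) ∤ P(1)`) with `rank E(ℚ) = 0` DISPLAYED: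
  `Ш(E/ℚ)[2^∞]` is finite and `#Ш(E/ℚ)[2^∞] = #Sel_(2^m)(E/ℚ)` for every `m ≥ M₀`.
* `natCard_shaPrimary_rat_eq_natCard_selmerGroup_two_pow_of_Δ_neg` — on Δ<0 the rank hypothesis is DISCHARGED mod Q2 (gk2-p4 g23
  `mordellWeilRank_rat_eq_zero_onHabitat`: Kolyvagin over `ℚ` at `2`, no L-value), so NO GZK.
* ★ `kFourNeg_conclusion_iff_natCard_selmerGroup_eq_pow` — **K4Neg's conclusion ⟺ `#Sel_(2^M₀)(E/ℚ) = 4^(M₀)`** on LEAD's frame VERBATIM (mod Q2).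
* `kFourNeg_conclusion_iff_natCard_selmerGroup_ne` — **⟺ `#Sel_(2^M₀)(E/ℚ) ≠ #Sel_(2^(M₀−1))(E/ℚ)`**; depth two
  `kFourNeg_conclusion_iff_natCard_selmerGroup_four_ne_four_of_depth_two` — **⟺ `#Sel₄(E/ℚ) ≠ 4`**.
INSTRUMENT: as for K₄⁺ — the per-curve K₄ test at depth `M₀` is ONE `2^(M₀)`-descent count over `ℚ` (BSD predicts `4^(M₀)`).  Class-wide = the
`2`-part of BSD in rank `0` given the Gross–Zagier index: OPEN.  BSD is NOT proved by any of this.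

References: [SilvermanAEC2009] Thm. X.4.2; [Kolyvagin1989Izv] Thm. B₂; [McCallumLMS1991] §5 Thm. 5.4, Cor. 5.6; [GrossLMS1991] §1 Thm. 1.3; [Mazur1977] Ch. III §5.
-/

set_option autoImplicit false
-- the Theorems namespace of this sub repeats the summit name by design (D-0017 nested layout)
set_option linter.dupNamespace false

noncomputable section

open scoped Classical
open scoped AddSubgroup

namespace Summit.BirchSwinnertonDyer.BirchSwinnertonDyer.Theorems.GenusExact.PlusDescent

open WeierstrassCurve NumberField IsDedekindDomain Field Literature.NumberTheory.EllipticCurves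
  Literature.NumberTheory.GaloisRepresentations Literature.NumberTheory.EllipticCurves.ModularForms AddSubgroup
  Literature.NumberTheory.EllipticCurves.RingClassField
open Summit.BirchSwinnertonDyer.BirchSwinnertonDyer.Theses.GenusKolyvaginAtTwo (KolyvaginRelationAtTwo)
open Summit.BirchSwinnertonDyer.BirchSwinnertonDyer.Theorems.GenusSupplyNarrow.KFourCell.ShaCardCurrency
  (kFourNeg_conclusion_iff_natCard_sha_rat_eq_pow)
open Summit.BirchSwinnertonDyer.BirchSwinnertonDyer.Theorems.GenusExact.ShaCores
  (exists_mem_sha_two_pow_pred_smul_ne_zero_of_natCard_shaPrimary_eq_pow)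

/-! ## §1 `#Ш(E/ℚ)[2^∞] = #Sel_(2^M₀)(E/ℚ)` — sign-free with `rank E(ℚ) = 0` displayed; on Δ<0 modulo Q2 only -/

/-- **`#Ш(E/ℚ)[2^∞] = #Sel_(2^m)(E/ℚ)` for every `m ≥ M₀`, and `Ш(E/ℚ)[2^∞]` is finite — SIGN-FREE, modulo Q2, with `rank E(ℚ) = 0` DISPLAYED.**
Frame of B₂ over `ℚ` (`two_pow_M0_smul_eq_zero_of_mem_sha_rat_signFree`): non-CM `E/ℚ` globally minimal, odd Tamagawa product, an odd
multiplicative prime `v`, `ρ_{E,2^n}` onto; `K` imaginary quadratic, `d_K` odd `≠ −3`, Heegner, the two Theorem-B₂ non-squares; `w(E) = +1`; `d₁`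
with `2^(M₀+1) ∤ P(1)`.  Then `2^(M₀) · Ш(E/ℚ)[2^∞] = 0`, so `Ш(E/ℚ)[2^∞] = Ш(E/ℚ)[2^(M₀)]` is finite and (prequel §1, `E(ℚ)[2] = 0` from `ρ̄_{E,2}`
onto) `#Sel_(2^m)(E/ℚ) = #Ш(E/ℚ)[2^m] = #Ш(E/ℚ)[2^∞]`.  BSD is NOT proved by this. [cite: Kolyvagin1989Izv, Thm. B₂] [cite: SilvermanAEC2009, Thm. X.4.2] -/
theorem natCard_shaPrimary_rat_eq_natCard_selmerGroup_two_pow_of_rank_zero (hQ2 : KolyvaginRelationAtTwo)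
    (W : WeierstrassCurve ℚ) [W.IsElliptic] [W.IsGloballyMinimal] [NeZero (W.conductorNorm ℤ)] (hcm : ¬ W.HasCM)
    (hT : Odd W.tamagawaProduct) (v : HeightOneSpectrum (𝓞 ℚ)) (h2v : ((2 : ℕ) : 𝓞 ℚ) ∉ v.asIdeal)
    (hNv : ((W.conductorNorm ℤ : ℕ) : 𝓞 ℚ) ∈ v.asIdeal) (hmult : W.HasMultiplicativeReductionAt v)
    (K : Type) [Field K] [NumberField K] (hIQ : IsImaginaryQuadratic K) (hodd : Odd (NumberField.discr K))
    (h3 : NumberField.discr K ≠ -3) (hHe : SatisfiesHeegnerHypothesis (W.conductorNorm ℤ) K)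
    (hsq1 : ¬ IsSquare ((NumberField.discr K : ℚ) * -|W.Δ|)) (hsq2 : ¬ IsSquare ((NumberField.discr K : ℚ) * (-(2 * |W.Δ|))))
    (hρ : ∀ n : ℕ, 0 < n → W.HasSurjectiveModNGaloisRep ((2 : ℤ) ^ n))
    (Dt : ModularParametrizationData W (W.conductorNorm ℤ)) (β : ℤ) (ι : K →+* ℂ) (d₁ : KolyvaginHeegnerData Dt β ι 1) (M₀ : ℕ)
    (hndiv : ¬ ∃ Q : (W.baseChange (ringClassField K ι 1)).toAffine.Point, ((2 ^ (M₀ + 1) : ℕ) : ℤ) • Q = d₁.derivedPoint)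
    (hw1 : W.rootNumber = 1) (hrk0 : W.mordellWeilRank = 0) {m : ℕ} (hm : M₀ ≤ m) :
    Finite (AddCommGroup.primaryComponent (↥W.sha) 2) ∧
      Nat.card (AddCommGroup.primaryComponent (↥W.sha) 2) = Nat.card (W.selmerGroup ((2 ^ m : ℕ) : ℤ)) := by
  have hs2 : W.HasSurjectiveModNGaloisRep 2 := by simpa using hρ 1 one_pos
  -- `E(ℚ)[2] = 0` (`convert` bridges the decidable-equality instance on `E(ℚ)` used by the general-`F` lemmas)
  have h2t := forall_eq_zero_of_two_zsmul_eq_zero_of_natCard_torsionBy_two_eq_one W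
    (by convert natCard_torsionBy_point_two_eq_one_of_hasSurjectiveModNGaloisRep_two W hs2)
  -- B₂ over `ℚ`: `2^(M₀)` kills `Ш(E/ℚ)[2^∞]`
  have hexp : ∀ a ∈ AddCommGroup.primaryComponent (↥W.sha) 2, 2 ^ M₀ • a = 0 := by
    intro a ha
    obtain ⟨k, hk⟩ := (AddCommGroup.mem_primaryComponent).mp ha
    have hka : ((2 ^ k : ℕ) : ℤ) • (a : W.galH1) = 0 := by
      rw [natCast_zsmul, ← AddSubgroupClass.coe_nsmul, hk, ZeroMemClass.coe_zero]
    have h := two_pow_M0_smul_eq_zero_of_mem_sha_rat_signFree hQ2 W hcm hT v h2v hNv hmult K hIQ hodd h3 hHe hsq1 hsq2 hρ Dt β ι d₁ M₀ hndiv hw1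
      k a a.2 hka
    exact Subtype.ext (by rw [AddSubgroupClass.coe_nsmul, ZeroMemClass.coe_zero, ← natCast_zsmul]; exact h)
  exact ⟨finite_primaryComponent_sha_of_exponent W hexp, (natCard_selmerGroup_two_pow_eq_natCard_primaryComponent W hrk0 h2t hm hexp).symm⟩

/-- **`#Ш(E/ℚ)[2^∞] = #Sel_(2^m)(E/ℚ)` for every `m ≥ M₀` on the Δ<0 cut frame, modulo Q2 ONLY** (no GZK): the rank hypothesis of
`…_of_rank_zero` is discharged by gk2-p4 g23's `mordellWeilRank_rat_eq_zero_onHabitat` (Kolyvagin's theorem over `ℚ` AT `2` from the Heegner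
index and Q2 — no L-value input).  BSD is NOT proved by this. [cite: Kolyvagin1989Izv, Thm. B₂] [cite: GrossLMS1991, §1 Thm. 1.3] [cite: SilvermanAEC2009, Thm. X.4.2] -/
theorem natCard_shaPrimary_rat_eq_natCard_selmerGroup_two_pow_of_Δ_neg (hQ2 : KolyvaginRelationAtTwo)
    (W : WeierstrassCurve ℚ) [W.IsElliptic] [W.IsGloballyMinimal] [NeZero (W.conductorNorm ℤ)] (hcm : ¬ W.HasCM)
    (hT : Odd W.tamagawaProduct) (v : HeightOneSpectrum (𝓞 ℚ)) (h2v : ((2 : ℕ) : 𝓞 ℚ) ∉ v.asIdeal)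
    (hNv : ((W.conductorNorm ℤ : ℕ) : 𝓞 ℚ) ∈ v.asIdeal) (hmult : W.HasMultiplicativeReductionAt v) (hneg : W.Δ < 0)
    (K : Type) [Field K] [NumberField K] (hIQ : IsImaginaryQuadratic K) (hodd : Odd (NumberField.discr K))
    (h3 : NumberField.discr K ≠ -3) (hHe : SatisfiesHeegnerHypothesis (W.conductorNorm ℤ) K)
    (hsq1 : ¬ IsSquare ((NumberField.discr K : ℚ) * -|W.Δ|)) (hsq2 : ¬ IsSquare ((NumberField.discr K : ℚ) * (-(2 * |W.Δ|))))
    (hρ : ∀ n : ℕ, 0 < n → W.HasSurjectiveModNGaloisRep ((2 : ℤ) ^ n))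
    (Dt : ModularParametrizationData W (W.conductorNorm ℤ)) (β : ℤ) (ι : K →+* ℂ) (d₁ : KolyvaginHeegnerData Dt β ι 1) (M₀ : ℕ)
    (hndiv : ¬ ∃ Q : (W.baseChange (ringClassField K ι 1)).toAffine.Point, ((2 ^ (M₀ + 1) : ℕ) : ℤ) • Q = d₁.derivedPoint)
    (hw1 : W.rootNumber = 1) {m : ℕ} (hm : M₀ ≤ m) :
    Finite (AddCommGroup.primaryComponent (↥W.sha) 2) ∧
      Nat.card (AddCommGroup.primaryComponent (↥W.sha) 2) = Nat.card (W.selmerGroup ((2 ^ m : ℕ) : ℤ)) :=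
  natCard_shaPrimary_rat_eq_natCard_selmerGroup_two_pow_of_rank_zero hQ2 W hcm hT v h2v hNv hmult K hIQ hodd h3 hHe hsq1 hsq2 hρ Dt β ι d₁ M₀
    hndiv hw1 (mordellWeilRank_rat_eq_zero_onHabitat hQ2 W hcm hT v h2v hNv hmult hneg K hIQ hodd h3 hHe hsq1 hsq2 hρ Dt β ι d₁ M₀ hndiv hw1) hm

/-! ## §2 ★ K4Neg ⟺ `#Sel_(2^M₀)(E/ℚ) = 4^(M₀)` ⟺ `#Sel_(2^M₀)(E/ℚ) ≠ #Sel_(2^(M₀−1))(E/ℚ)`, on LEAD's frame VERBATIM -/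

/-- ★ **K4Neg's CONCLUSION ⟺ `#Sel_(2^M₀)(E/ℚ) = 4^(M₀)`** on K4Neg's frame (LEAD gk2-p1 g24's binders VERBATIM: the K4Neg binders + one odd
multiplicative prime `v`), modulo Q2 ONLY: LEAD's `kFourNeg_conclusion_iff_natCard_sha_rat_eq_pow` (K4Neg ⟺ `#Ш(E/ℚ)[2^∞] = 2^(2M₀)`) composed with
§1 (`#Ш(E/ℚ)[2^∞] = #Sel_(2^M₀)(E/ℚ)`).  The per-curve content of K₄ at depth `M₀` is the single number `#Sel_(2^M₀)(E/ℚ)` (BSD predicts `4^(M₀)`);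
class-wide = the `2`-part of BSD in rank `0` given the Gross–Zagier index — OPEN.  BSD is NOT proved by this; neither side is proved here.
[cite: Kolyvagin1989Izv, Thm. B₂] [cite: McCallumLMS1991, §5 Thm. 5.4, Cor. 5.6] [cite: SilvermanAEC2009, Thm. X.4.2] -/
theorem kFourNeg_conclusion_iff_natCard_selmerGroup_eq_pow (hQ2 : KolyvaginRelationAtTwo)
    (W : WeierstrassCurve ℚ) [W.IsElliptic] [W.IsGloballyMinimal] [NeZero (W.conductorNorm ℤ)] (hcm : ¬ W.HasCM)
    (hr0 : W.analyticRank = 0) (hρ : ∀ n : ℕ, 0 < n → W.HasSurjectiveModNGaloisRep ((2 : ℤ) ^ n)) (hT : Odd W.tamagawaProduct)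
    (hneg : W.Δ < 0) (h4 : Nat.card (W.selmerGroup 2) = 4)
    (K : Type) [Field K] [NumberField K] (hIQ : IsImaginaryQuadratic K) (hodd : Odd (NumberField.discr K))
    (h3 : NumberField.discr K ≠ -3) (hHe : SatisfiesHeegnerHypothesis (W.conductorNorm ℤ) K)
    (hsq1 : ¬ IsSquare ((NumberField.discr K : ℚ) * -|W.Δ|)) (hsq2 : ¬ IsSquare ((NumberField.discr K : ℚ) * (-(2 * |W.Δ|))))
    (ℓ₀ : ℕ) (hℓ₀ : ℓ₀.Prime) (hdK : NumberField.discr K = -(ℓ₀ : ℤ))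
    (h2K : ((Ideal.span {(2 : ℤ)}).primesOver (𝓞 K)).ncard = 2)
    (Dt : ModularParametrizationData W (W.conductorNorm ℤ))
    (hopt : ∀ z ∈ Dt.L.lattice, ∃ w ∈ periodLattice Dt.f, z = (Dt.c : ℂ) * w) (hc : Odd Dt.c)
    (β : ℤ) (ι : K →+* ℂ) (d₁ : KolyvaginHeegnerData Dt β ι 1) (hy : ¬ IsOfFinAddOrder d₁.derivedPoint) (M₀ : ℕ)
    (hdiv : ∃ Q : (W.baseChange (ringClassField K ι 1)).toAffine.Point, ((2 ^ M₀ : ℕ) : ℤ) • Q = d₁.derivedPoint)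
    (hndiv : ¬ ∃ Q : (W.baseChange (ringClassField K ι 1)).toAffine.Point, ((2 ^ (M₀ + 1) : ℕ) : ℤ) • Q = d₁.derivedPoint)
    (hM₀ : 1 ≤ M₀) (Wd : WeierstrassCurve ℚ) [Wd.IsElliptic] [Wd.IsGloballyMinimal]
    (hWd : ∃ C : VariableChange ℚ, C • W.quadraticTwist (NumberField.discr K : ℚ) = Wd) (hrd : Wd.analyticRank = 1)
    (hSel : Nat.card (Wd.selmerGroup 2) = 2) (hDEF : padicValNat 2 Wd.tamagawaProduct ≤ 1)
    (v : HeightOneSpectrum (𝓞 ℚ)) (h2v : ((2 : ℕ) : 𝓞 ℚ) ∉ v.asIdeal) (hNv : ((W.conductorNorm ℤ : ℕ) : 𝓞 ℚ) ∈ v.asIdeal)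
    (hmult : W.HasMultiplicativeReductionAt v) :
    (∃ (n : ℕ) (d : KolyvaginHeegnerData Dt β ι n), Squarefree n ∧
      (∀ ℓ ∈ n.primeFactors, Zhang2014.IsKolyvaginPrime (W.conductorNorm ℤ) W K 2 ℓ ∧ 2 ≤ Zhang2014.kolyvaginIndex W 2 ℓ ∧
        FrobEqFrobInfty W K 2 ℓ) ∧
      ¬ ∃ Q : (W.baseChange (ringClassField K ι n)).toAffine.Point, (2 : ℤ) • Q = d.derivedPoint) ↔
    Nat.card (W.selmerGroup ((2 ^ M₀ : ℕ) : ℤ)) = 4 ^ M₀ := by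
  have hw : W.rootNumber = 1 :=
    (Literature.Barriers.BirchSwinnertonDyer.even_analyticRank_iff_of_isNewformOf_conductorLevel Dt.isNewformOf).mp
      (by rw [hr0]; exact Even.zero)
  obtain ⟨-, hcard⟩ := natCard_shaPrimary_rat_eq_natCard_selmerGroup_two_pow_of_Δ_neg hQ2 W hcm hT v h2v hNv hmult hneg K hIQ hodd h3 hHe hsq1
    hsq2 hρ Dt β ι d₁ M₀ hndiv hw (le_refl M₀)
  rw [kFourNeg_conclusion_iff_natCard_sha_rat_eq_pow hQ2 W hcm hr0 hρ hT hneg h4 K hIQ hodd h3 hHe hsq1 hsq2 ℓ₀ hℓ₀ hdK h2K Dt hopt hc β ι d₁ hy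
    M₀ hdiv hndiv hM₀ Wd hWd hrd hSel hDEF v h2v hNv hmult, hcard, pow_mul]
  norm_num

/-- **K4Neg's CONCLUSION ⟺ `#Sel_(2^M₀)(E/ℚ) ≠ #Sel_(2^(M₀−1))(E/ℚ)`** on the same frame, modulo Q2 ONLY — the `2^(M₀)`-descent over `ℚ` sees
STRICTLY more than the `2^(M₀−1)`-descent.  (⟹) ★ gives `#Ш(E/ℚ)[2^∞] = 4^(M₀)`; gk2-p4 g29's counting
(`ShaCores.exists_mem_sha_two_pow_pred_smul_ne_zero_of_natCard_shaPrimary_eq_pow`, `#Sel₂(E) ∣ 4`) gives a class not killed by `2^(M₀−1)`, B₂ kills it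
by `2^(M₀)`, and the prequel's §1 (`#Sel_(2^j) = #Ш[2^j]`, rank `0` mod Q2) reads the two counts as different.  (⟸) different counts give a class
of `Ш(E/ℚ)[2^(M₀)]` of order `2^(M₀)`, lifted to `Sel_(2^M₀)(E/ℚ)` (Kummer, `map_torsionH1ToH1_selmerGroup_holds`) and fed to g36's
`kFourNeg_shape_of_two_pow_pred_smul_ne_zero` (B2Q♭ with the `FrobEqFrobInfty` clause).  BSD is NOT proved by this; neither side is proved here.
[cite: Kolyvagin1989Izv, Thm. B₂] [cite: McCallumLMS1991, §5 Thm. 5.4, Cor. 5.6] [cite: SilvermanAEC2009, Thm. X.4.2] -/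
theorem kFourNeg_conclusion_iff_natCard_selmerGroup_ne (hQ2 : KolyvaginRelationAtTwo)
    (W : WeierstrassCurve ℚ) [W.IsElliptic] [W.IsGloballyMinimal] [NeZero (W.conductorNorm ℤ)] (hcm : ¬ W.HasCM)
    (hr0 : W.analyticRank = 0) (hρ : ∀ n : ℕ, 0 < n → W.HasSurjectiveModNGaloisRep ((2 : ℤ) ^ n)) (hT : Odd W.tamagawaProduct)
    (hneg : W.Δ < 0) (h4 : Nat.card (W.selmerGroup 2) = 4)
    (K : Type) [Field K] [NumberField K] (hIQ : IsImaginaryQuadratic K) (hodd : Odd (NumberField.discr K))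
    (h3 : NumberField.discr K ≠ -3) (hHe : SatisfiesHeegnerHypothesis (W.conductorNorm ℤ) K)
    (hsq1 : ¬ IsSquare ((NumberField.discr K : ℚ) * -|W.Δ|)) (hsq2 : ¬ IsSquare ((NumberField.discr K : ℚ) * (-(2 * |W.Δ|))))
    (ℓ₀ : ℕ) (hℓ₀ : ℓ₀.Prime) (hdK : NumberField.discr K = -(ℓ₀ : ℤ))
    (h2K : ((Ideal.span {(2 : ℤ)}).primesOver (𝓞 K)).ncard = 2)
    (Dt : ModularParametrizationData W (W.conductorNorm ℤ))
    (hopt : ∀ z ∈ Dt.L.lattice, ∃ w ∈ periodLattice Dt.f, z = (Dt.c : ℂ) * w) (hc : Odd Dt.c)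
    (β : ℤ) (ι : K →+* ℂ) (d₁ : KolyvaginHeegnerData Dt β ι 1) (hy : ¬ IsOfFinAddOrder d₁.derivedPoint) (M₀ : ℕ)
    (hdiv : ∃ Q : (W.baseChange (ringClassField K ι 1)).toAffine.Point, ((2 ^ M₀ : ℕ) : ℤ) • Q = d₁.derivedPoint)
    (hndiv : ¬ ∃ Q : (W.baseChange (ringClassField K ι 1)).toAffine.Point, ((2 ^ (M₀ + 1) : ℕ) : ℤ) • Q = d₁.derivedPoint)
    (hM₀ : 1 ≤ M₀) (Wd : WeierstrassCurve ℚ) [Wd.IsElliptic] [Wd.IsGloballyMinimal]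
    (hWd : ∃ C : VariableChange ℚ, C • W.quadraticTwist (NumberField.discr K : ℚ) = Wd) (hrd : Wd.analyticRank = 1)
    (hSel : Nat.card (Wd.selmerGroup 2) = 2) (hDEF : padicValNat 2 Wd.tamagawaProduct ≤ 1)
    (v : HeightOneSpectrum (𝓞 ℚ)) (h2v : ((2 : ℕ) : 𝓞 ℚ) ∉ v.asIdeal) (hNv : ((W.conductorNorm ℤ : ℕ) : 𝓞 ℚ) ∈ v.asIdeal)
    (hmult : W.HasMultiplicativeReductionAt v) :
    (∃ (n : ℕ) (d : KolyvaginHeegnerData Dt β ι n), Squarefree n ∧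
      (∀ ℓ ∈ n.primeFactors, Zhang2014.IsKolyvaginPrime (W.conductorNorm ℤ) W K 2 ℓ ∧ 2 ≤ Zhang2014.kolyvaginIndex W 2 ℓ ∧
        FrobEqFrobInfty W K 2 ℓ) ∧
      ¬ ∃ Q : (W.baseChange (ringClassField K ι n)).toAffine.Point, (2 : ℤ) • Q = d.derivedPoint) ↔
    Nat.card (W.selmerGroup ((2 ^ M₀ : ℕ) : ℤ)) ≠ Nat.card (W.selmerGroup ((2 ^ (M₀ - 1) : ℕ) : ℤ)) := by
  haveI : Fact (Nat.Prime 2) := ⟨Nat.prime_two⟩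
  have hs2 : W.HasSurjectiveModNGaloisRep 2 := by simpa using hρ 1 one_pos
  have hw : W.rootNumber = 1 :=
    (Literature.Barriers.BirchSwinnertonDyer.even_analyticRank_iff_of_isNewformOf_conductorLevel Dt.isNewformOf).mp
      (by rw [hr0]; exact Even.zero)
  have hrk0 : W.mordellWeilRank = 0 :=
    mordellWeilRank_rat_eq_zero_onHabitat hQ2 W hcm hT v h2v hNv hmult hneg K hIQ hodd h3 hHe hsq1 hsq2 hρ Dt β ι d₁ M₀ hndiv hw
  have h2t := forall_eq_zero_of_two_zsmul_eq_zero_of_natCard_torsionBy_two_eq_one W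
    (by convert natCard_torsionBy_point_two_eq_one_of_hasSurjectiveModNGaloisRep_two W hs2)
  obtain ⟨hfin, hcard⟩ := natCard_shaPrimary_rat_eq_natCard_selmerGroup_two_pow_of_Δ_neg hQ2 W hcm hT v h2v hNv hmult hneg K hIQ hodd h3 hHe
    hsq1 hsq2 hρ Dt β ι d₁ M₀ hndiv hw (le_refl M₀)
  haveI := hfin
  rw [kFourNeg_conclusion_iff_natCard_selmerGroup_eq_pow hQ2 W hcm hr0 hρ hT hneg h4 K hIQ hodd h3 hHe hsq1 hsq2 ℓ₀ hℓ₀ hdK h2K Dt hopt hc β ι d₁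
    hy M₀ hdiv hndiv hM₀ Wd hWd hrd hSel hDEF v h2v hNv hmult,
    ← exists_mem_sha_two_pow_smul_ne_zero_iff_natCard_selmerGroup_ne W hrk0 h2t hM₀]
  constructor
  · intro hSelM₀
    have hY : Nat.card (AddCommGroup.primaryComponent (↥W.sha) 2) = 4 ^ M₀ := by rw [hcard, hSelM₀]
    obtain ⟨k, a, ha, hka, hne⟩ := exists_mem_sha_two_pow_pred_smul_ne_zero_of_natCard_shaPrimary_eq_pow W hM₀ (by rw [h4]) hY
    exact ⟨a, ha, two_pow_M0_smul_eq_zero_of_mem_sha_rat_signFree hQ2 W hcm hT v h2v hNv hmult K hIQ hodd h3 hHe hsq1 hsq2 hρ Dt β ι d₁ M₀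
      hndiv hw k a ha hka, hne⟩
  · rintro ⟨a, ha, hka, hne⟩
    -- lift `a ∈ Ш(E/ℚ)[2^(M₀)]` to `Sel_(2^M₀)(E/ℚ)` and run B2Q♭ (K4Neg shape); then ★ reads the count
    have hnz : ((2 ^ M₀ : ℕ) : ℤ) ≠ 0 := by positivity
    have hmem : a ∈ W.sha ⊓ torsionBy W.galH1 ((2 ^ M₀ : ℕ) : ℤ) :=
      AddSubgroup.mem_inf.mpr ⟨ha, by change ((2 ^ M₀ : ℕ) : ℤ) • a = 0; exact hka⟩
    rw [← WeierstrassCurve.map_torsionH1ToH1_selmerGroup_holds W hnz] at hmem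
    obtain ⟨x, hx, rfl⟩ := AddSubgroup.mem_map.mp hmem
    have hne' : ((2 ^ (M₀ - 1) : ℕ) : ℤ) • x ≠ 0 := fun h ↦ hne (by rw [← map_zsmul, h, map_zero])
    have hK4 := kFourNeg_shape_of_two_pow_pred_smul_ne_zero hQ2 W hcm hneg hT v h2v hNv hmult K hIQ hodd h3 hHe hsq1 hsq2 hρ Dt β ι d₁ M₀ hndiv hw
      ⟨M₀, x, hx, hne'⟩
    exact (kFourNeg_conclusion_iff_natCard_selmerGroup_eq_pow hQ2 W hcm hr0 hρ hT hneg h4 K hIQ hodd h3 hHe hsq1 hsq2 ℓ₀ hℓ₀ hdK h2K Dt hopt hc β ι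
      d₁ hy M₀ hdiv hndiv hM₀ Wd hWd hrd hSel hDEF v h2v hNv hmult).mp hK4

/-- **DEPTH TWO: K4Neg's conclusion ⟺ `#Sel₄(E/ℚ) ≠ 4`** on the `M₀ = 2` sub-cell of the same frame (where `#Sel₂(E/ℚ) = 4`), modulo Q2 ONLY —
the per-curve test BSD predicts to pass on every WALL-row-1 census cell with `16 ∥ #Ш_an(E)` is ONE `4`-descent count over `ℚ`.  BSD / K4Neg
are NOT proved by this. [cite: Kolyvagin1989Izv, Thm. B₂] [cite: McCallumLMS1991, §5 Thm. 5.4] [cite: SilvermanAEC2009, Thm. X.4.2] -/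
theorem kFourNeg_conclusion_iff_natCard_selmerGroup_four_ne_four_of_depth_two (hQ2 : KolyvaginRelationAtTwo)
    (W : WeierstrassCurve ℚ) [W.IsElliptic] [W.IsGloballyMinimal] [NeZero (W.conductorNorm ℤ)] (hcm : ¬ W.HasCM)
    (hr0 : W.analyticRank = 0) (hρ : ∀ n : ℕ, 0 < n → W.HasSurjectiveModNGaloisRep ((2 : ℤ) ^ n)) (hT : Odd W.tamagawaProduct)
    (hneg : W.Δ < 0) (h4 : Nat.card (W.selmerGroup 2) = 4)
    (K : Type) [Field K] [NumberField K] (hIQ : IsImaginaryQuadratic K) (hodd : Odd (NumberField.discr K))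
    (h3 : NumberField.discr K ≠ -3) (hHe : SatisfiesHeegnerHypothesis (W.conductorNorm ℤ) K)
    (hsq1 : ¬ IsSquare ((NumberField.discr K : ℚ) * -|W.Δ|)) (hsq2 : ¬ IsSquare ((NumberField.discr K : ℚ) * (-(2 * |W.Δ|))))
    (ℓ₀ : ℕ) (hℓ₀ : ℓ₀.Prime) (hdK : NumberField.discr K = -(ℓ₀ : ℤ))
    (h2K : ((Ideal.span {(2 : ℤ)}).primesOver (𝓞 K)).ncard = 2)
    (Dt : ModularParametrizationData W (W.conductorNorm ℤ))
    (hopt : ∀ z ∈ Dt.L.lattice, ∃ w ∈ periodLattice Dt.f, z = (Dt.c : ℂ) * w) (hc : Odd Dt.c)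
    (β : ℤ) (ι : K →+* ℂ) (d₁ : KolyvaginHeegnerData Dt β ι 1) (hy : ¬ IsOfFinAddOrder d₁.derivedPoint)
    (hdiv : ∃ Q : (W.baseChange (ringClassField K ι 1)).toAffine.Point, ((2 ^ 2 : ℕ) : ℤ) • Q = d₁.derivedPoint)
    (hndiv : ¬ ∃ Q : (W.baseChange (ringClassField K ι 1)).toAffine.Point, ((2 ^ (2 + 1) : ℕ) : ℤ) • Q = d₁.derivedPoint)
    (Wd : WeierstrassCurve ℚ) [Wd.IsElliptic] [Wd.IsGloballyMinimal]
    (hWd : ∃ C : VariableChange ℚ, C • W.quadraticTwist (NumberField.discr K : ℚ) = Wd) (hrd : Wd.analyticRank = 1)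
    (hSel : Nat.card (Wd.selmerGroup 2) = 2) (hDEF : padicValNat 2 Wd.tamagawaProduct ≤ 1)
    (v : HeightOneSpectrum (𝓞 ℚ)) (h2v : ((2 : ℕ) : 𝓞 ℚ) ∉ v.asIdeal) (hNv : ((W.conductorNorm ℤ : ℕ) : 𝓞 ℚ) ∈ v.asIdeal)
    (hmult : W.HasMultiplicativeReductionAt v) :
    (∃ (n : ℕ) (d : KolyvaginHeegnerData Dt β ι n), Squarefree n ∧
      (∀ ℓ ∈ n.primeFactors, Zhang2014.IsKolyvaginPrime (W.conductorNorm ℤ) W K 2 ℓ ∧ 2 ≤ Zhang2014.kolyvaginIndex W 2 ℓ ∧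
        FrobEqFrobInfty W K 2 ℓ) ∧
      ¬ ∃ Q : (W.baseChange (ringClassField K ι n)).toAffine.Point, (2 : ℤ) • Q = d.derivedPoint) ↔
    Nat.card (W.selmerGroup 4) ≠ 4 := by
  have h := kFourNeg_conclusion_iff_natCard_selmerGroup_ne hQ2 W hcm hr0 hρ hT hneg h4 K hIQ hodd h3 hHe hsq1 hsq2 ℓ₀ hℓ₀ hdK h2K Dt hopt hc β ι
    d₁ hy 2 hdiv hndiv (by norm_num) Wd hWd hrd hSel hDEF v h2v hNv hmult
  have e4 : ((2 ^ 2 : ℕ) : ℤ) = 4 := by norm_num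
  have e2 : ((2 ^ (2 - 1) : ℕ) : ℤ) = 2 := by norm_num
  rw [e4, e2, h4] at h
  exact h

end Summit.BirchSwinnertonDyer.BirchSwinnertonDyer.Theorems.GenusExact.PlusDescent

end
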